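/-
Copyright: harness cell b2b-lgcu-borel (gen 28).  Honest framing: the VALUE here is a THEOREM
(the exact integer ORDER WINDOW of the members of a would-be level-one witness at
`(m, p) = (3, 11)` and `(3, 13)`, i.e. the search space of the structured member censuses of
gen 26 certified from landed laws) — NOT summit progress; the crux item `SubgroupIdentityDesigns`
(stmt-MatrixMultiplication-14079) stays open and untouched.
-/
import Mathlib
import Summits.MatrixMultiplication.MatrixMultiplication.Theorems.SubgroupIdentityDesigns.Negative.LevelOneWindowAll

/-!
# The member ORDER WINDOW of the open level-one cells `(3, 11)` and `(3, 13)`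

Route `LevelGradedCohnUmans`, crux `SubgroupIdentityDesigns`, negative side; level `k = 1`.

`LevelOneWindowAll.levelOne_member_window` bounds the members of a level-one witness in every
dimension by `b ≤ |Hᵢ|`, `|Hᵢ| + 3 ≤ p^{1+l}`.  The structured member censuses of the two first open
cells in dimension three (`run/shared/lean/b2b/levelgraded-cu/ORACLE-g26.md` §G26-4, §G26-7) were run
on much smaller windows — `154 ≤ |Hᵢ| ≤ 993`, ends `≤ 332` at `p = 11`; `208 ≤ |Hᵢ| ≤ 1708`, ends
`≤ 549` at `p = 13` — obtained by a Python enumeration of the integer region cut out by the landed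
laws.  This file CERTIFIES those windows in Lean, from the same landed laws and nothing else:

* the two graded Neumann counts `x z + x (y − 1) ≤ D`, `x z + (y − 1) z ≤ D`
  (`WitnessNeumannCounts.crux_neumann`), the volume law `V + u²(u − 1) ≤ u D`, `u = min (x, z)`
  (`WitnessNeumannCounts.crux_volume_law`), the dimension formula `D + 2b ≤ (p − 1) b² + 2`
  (`LevelOneFloorAll.finrank_le_formula_nat`), the floor `(p − 1) b³ + 3 b + 1 ≤ V + 3 b²`
  (`LevelOneFloorAll.volume_gt_floor_nat`, `−2 < ε ≤ 1`), and Lagrange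
  (`Subgroup.card_subgroup_dvd_card` with Mathlib's `Matrix.card_GL_field`:
  `|GL₃(𝔽₁₁)| = 2 124 276 000`, `|GL₃(𝔽₁₃)| = 9 726 417 792`);
* `member_window_three_eleven` : **at `(3, 11)`, for every `−2 < ε ≤ 1`, every member of a witness
  has `154 ≤ |Hᵢ| ≤ 993` and the two outer members have `|H₁|, |H₃| ≤ 330`;**
* `member_window_three_thirteen` : **at `(3, 13)`: `208 ≤ |Hᵢ| ≤ 1708`, outer members `≤ 549`;**
* `crux_member_window_three_eleven` / `_thirteen` : the same against the crux clause verbatim.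

The arithmetic is elementary (AM–GM `(D + x)² ≥ 4 x V` for the outer members, the quadratic
`V ≤ y D − u y (y − 1)` for the middle member, `interval_cases` on the volume law for the lower end,
and divisibility strips at the boundaries); every numeric certificate is checked by `norm_num` /
`omega` / `nlinarith`.  So the gen-26 census windows (`SetField(11,154,993,332)`,
`SetField(13,208,1708,549)`) and the gen-28 audit windows (`[154, 993]`, ends `≤ 333`;
`[204, 1765]`, ends `≤ 550`) contain every member order a witness could have.  Sorry-free; standard
axioms; no new definitions.  Report: `run/shared/lean/b2b/levelgraded-cu/ORACLE-g28.md`.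
-/

set_option linter.dupNamespace false

noncomputable section

open scoped BigOperators Classical Matrix
open Module (finrank)

namespace Summit.MatrixMultiplication.MatrixMultiplication.Theorems.SubgroupIdentityDesigns.Negative
namespace LevelOneMemberWindow

open Literature.Barriers.MatrixMultiplication (SubgroupTPP)
open Summit.MatrixMultiplication.MatrixMultiplication.Theorems.LieRankDesigns.Negative
  (GLm Mat budget)
open Summit.MatrixMultiplication.MatrixMultiplication.Theorems.LevelOneGL2Designs.Negative
  (levelSubmodule)
open WitnessNeumannCounts (crux_neumann crux_volume_law one_le_card)
open LevelOneFloorAll (volume_gt_floor_nat finrank_le_formula_nat)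

/-! ## Pure arithmetic -/

/-- Lower end from the volume law: `V + u²(u−1) ≤ u D`, `D ≤ Dm`, `Vm ≤ V` with the `(3,11)`
constants force `154 ≤ u`. -/
theorem lower_eleven {u D V : ℕ} (hu1 : 1 ≤ u) (hvol : V + u * u * (u - 1) ≤ u * D)
    (hD : D ≤ 176626) (hF : 23473703 ≤ V) : 154 ≤ u := by
  by_contra h
  push Not at h
  interval_cases u <;> omega

/-- Lower end at `(3,13)`: `204 ≤ u`. -/
theorem lower_thirteen {u D V : ℕ} (hu1 : 1 ≤ u) (hvol : V + u * u * (u - 1) ≤ u * D)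
    (hD : D ≤ 401504) (hF : 73441927 ≤ V) : 204 ≤ u := by
  by_contra h
  push Not at h
  interval_cases u <;> omega

/-- Outer member, AM–GM: `x (z + y − 1) ≤ D ≤ Dm` and `Vm ≤ x y z` give `4 x Vm ≤ (Dm + x)²`,
impossible for `334 ≤ x (≤ Dm)` at `(3,11)`. -/
theorem outer_eleven {x y z D : ℕ} (hy : 1 ≤ y) (hz : 1 ≤ z)
    (N1 : x * z + x * (y - 1) ≤ D) (hD : D ≤ 176626) (hF : 23473703 ≤ x * y * z) :
    x ≤ 333 := by
  by_contra h
  push Not at h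
  zify [hy] at N1 hD hF h hz
  have h1 : (x : ℤ) * (y + z) ≤ D + x := by linarith
  have h0 : (0 : ℤ) ≤ (x : ℤ) * (y + z) := by positivity
  have h2 : 4 * (x : ℤ) * (x * y * z) ≤ (x * (y + z)) ^ 2 := by
    nlinarith [sq_nonneg ((x : ℤ) * y - x * z)]
  have h3 : ((x : ℤ) * (y + z)) ^ 2 ≤ (176626 + x) ^ 2 := by
    have h1' : (x : ℤ) * (y + z) ≤ 176626 + x := by linarith
    nlinarith [mul_le_mul h1' h1' h0 (by linarith)]
  have hxD : (x : ℤ) ≤ 176626 := by nlinarith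
  have h4 : 4 * (x : ℤ) * 23473703 ≤ 4 * (x : ℤ) * (x * y * z) := by nlinarith
  nlinarith [mul_nonneg (sub_nonneg.2 h) (sub_nonneg.2 hxD)]

/-- Outer member at `(3,13)`: `x ≤ 550`. -/
theorem outer_thirteen {x y z D : ℕ} (hy : 1 ≤ y) (hz : 1 ≤ z)
    (N1 : x * z + x * (y - 1) ≤ D) (hD : D ≤ 401504) (hF : 73441927 ≤ x * y * z) :
    x ≤ 550 := by
  by_contra h
  push Not at h
  zify [hy] at N1 hD hF h hz
  have h1 : (x : ℤ) * (y + z) ≤ D + x := by linarith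
  have h0 : (0 : ℤ) ≤ (x : ℤ) * (y + z) := by positivity
  have h2 : 4 * (x : ℤ) * (x * y * z) ≤ (x * (y + z)) ^ 2 := by
    nlinarith [sq_nonneg ((x : ℤ) * y - x * z)]
  have h3 : ((x : ℤ) * (y + z)) ^ 2 ≤ (401504 + x) ^ 2 := by
    have h1' : (x : ℤ) * (y + z) ≤ 401504 + x := by linarith
    nlinarith [mul_le_mul h1' h1' h0 (by linarith)]
  have hxD : (x : ℤ) ≤ 401504 := by nlinarith
  have h4 : 4 * (x : ℤ) * 73441927 ≤ 4 * (x : ℤ) * (x * y * z) := by nlinarith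
  nlinarith [mul_nonneg (sub_nonneg.2 h) (sub_nonneg.2 hxD)]

/-- Middle member at `(3,11)`: with `154 ≤ x, z`, `x (z + y − 1) ≤ D ≤ 176626` and
`23473703 ≤ x y z`:  `154 ≤ y ≤ 993`. -/
theorem middle_eleven {x y z D : ℕ} (hx : 154 ≤ x) (hz : 154 ≤ z) (hy : 1 ≤ y)
    (N1 : x * z + x * (y - 1) ≤ D) (hD : D ≤ 176626) (hF : 23473703 ≤ x * y * z) :
    154 ≤ y ∧ y ≤ 993 := by
  zify [hy] at N1 hD hF hx hz ⊢
  have hy0 : (0 : ℤ) ≤ y := by positivity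
  have hy1 : (0 : ℤ) ≤ (y : ℤ) - 1 := by
    have : (1 : ℤ) ≤ y := by exact_mod_cast hy
    linarith
  -- upper: 154 (153 + y) ≤ x (z + y − 1) ≤ 176626
  have hup : (154 : ℤ) * (153 + y) ≤ 176626 := by
    nlinarith [mul_nonneg (sub_nonneg.2 hx) (by linarith : (0 : ℤ) ≤ z + y - 1)]
  -- lower: Vm ≤ x y z = y (x z) ≤ y (D − x (y − 1)) ≤ 176626 y − 154 y (y − 1)
  have hA : (y : ℤ) * (x * z) ≤ y * (D - x * (y - 1)) :=
    mul_le_mul_of_nonneg_left (by linarith) hy0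
  have hB : (154 : ℤ) * (y * (y - 1)) ≤ x * (y * (y - 1)) :=
    mul_le_mul_of_nonneg_right hx (mul_nonneg hy0 hy1)
  have hC : (y : ℤ) * D ≤ y * 176626 := mul_le_mul_of_nonneg_left hD hy0
  have hkey : (23473703 : ℤ) ≤ 176626 * y - 154 * (y * (y - 1)) := by nlinarith
  constructor
  · by_contra h
    push Not at h
    nlinarith [sq_nonneg ((y : ℤ) - 153)]
  · linarith

/-- Middle member at `(3,13)`: with `208 ≤ x, z`: `204 ≤ y ≤ 1723`. -/
theorem middle_thirteen {x y z D : ℕ} (hx : 208 ≤ x) (hz : 208 ≤ z) (hy : 1 ≤ y)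
    (N1 : x * z + x * (y - 1) ≤ D) (hD : D ≤ 401504) (hF : 73441927 ≤ x * y * z) :
    204 ≤ y ∧ y ≤ 1723 := by
  zify [hy] at N1 hD hF hx hz ⊢
  have hy0 : (0 : ℤ) ≤ y := by positivity
  have hy1 : (0 : ℤ) ≤ (y : ℤ) - 1 := by
    have : (1 : ℤ) ≤ y := by exact_mod_cast hy
    linarith
  have hup : (208 : ℤ) * (207 + y) ≤ 401504 := by
    nlinarith [mul_nonneg (sub_nonneg.2 hx) (by linarith : (0 : ℤ) ≤ z + y - 1)]
  have hA : (y : ℤ) * (x * z) ≤ y * (D - x * (y - 1)) :=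
    mul_le_mul_of_nonneg_left (by linarith) hy0
  have hB : (208 : ℤ) * (y * (y - 1)) ≤ x * (y * (y - 1)) :=
    mul_le_mul_of_nonneg_right hx (mul_nonneg hy0 hy1)
  have hC : (y : ℤ) * D ≤ y * 401504 := mul_le_mul_of_nonneg_left hD hy0
  have hkey : (73441927 : ℤ) ≤ 401504 * y - 208 * (y * (y - 1)) := by nlinarith
  constructor
  · by_contra h
    push Not at h
    nlinarith [sq_nonneg ((y : ℤ) - 203)]
  · linarith

/-- `|GL₃(𝔽₁₁)| = 2 124 276 000` (Mathlib `Matrix.card_GL_field`). -/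
theorem card_GL_three_eleven [Fact (Nat.Prime 11)] :
    Nat.card (GLm 11 (1 + 2)) = 2124276000 := by
  have h := Matrix.card_GL_field (𝔽 := ZMod 11) 3
  have e : ∏ i : Fin 3, (Fintype.card (ZMod 11) ^ 3 - Fintype.card (ZMod 11) ^ (i : ℕ)) =
      2124276000 := by
    rw [ZMod.card, Fin.prod_univ_three]
    simp only [Fin.val_zero, Fin.val_one, Fin.val_two]
    norm_num
  rw [e] at h
  exact h

/-- `|GL₃(𝔽₁₃)| = 9 726 417 792`. -/
theorem card_GL_three_thirteen [Fact (Nat.Prime 13)] :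
    Nat.card (GLm 13 (1 + 2)) = 9726417792 := by
  have h := Matrix.card_GL_field (𝔽 := ZMod 13) 3
  have e : ∏ i : Fin 3, (Fintype.card (ZMod 13) ^ 3 - Fintype.card (ZMod 13) ^ (i : ℕ)) =
      9726417792 := by
    rw [ZMod.card, Fin.prod_univ_three]
    simp only [Fin.val_zero, Fin.val_one, Fin.val_two]
    norm_num
  rw [e] at h
  exact h

/-! ## The windows -/

variable {p : ℕ} [hp : Fact p.Prime]

/-- **THE MEMBER WINDOW AT `(m, p) = (3, 11)`** (`−2 < ε ≤ 1`): every member of a subgroup-TPP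
triple with a level-one identity design satisfying the crux inequality has `154 ≤ |Hᵢ| ≤ 993`, and
the outer members have `|H₁|, |H₃| ≤ 330`. -/
theorem member_window_three_eleven (hp' : p = 11) {ε : ℝ} (hε : -2 < ε) (hε1 : ε ≤ 1)
    {H₁ H₂ H₃ : Subgroup (GLm p (1 + 2))} (htpp : SubgroupTPP H₁ H₂ H₃)
    (hdes : ∃ c : Mat p (1 + 2) → ℂ, (∀ M, 1 < M.rank → c M = 0) ∧
      (∑ M, c M * ZMod.stdAddChar (Matrix.trace (M * ((1 : GLm p (1 + 2)) : Mat p (1 + 2))))) = 1 ∧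
      ∀ a ∈ H₁, ∀ b ∈ H₂, ∀ g ∈ H₃, a * b * g ≠ 1 →
        (∑ M, c M * ZMod.stdAddChar
          (Matrix.trace (M * ((a * b * g : GLm p (1 + 2)) : Mat p (1 + 2))))) = 0)
    (hlt : budget p (1 + 2) 1 (2 + ε) <
      ((Nat.card H₁ * Nat.card H₂ * Nat.card H₃ : ℕ) : ℝ) ^ ((2 + ε) / 3)) :
    (154 ≤ Nat.card H₁ ∧ Nat.card H₁ ≤ 330) ∧ (154 ≤ Nat.card H₂ ∧ Nat.card H₂ ≤ 993) ∧
      (154 ≤ Nat.card H₃ ∧ Nat.card H₃ ≤ 330) := by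
  subst hp'
  obtain ⟨N1, N2⟩ := crux_neumann (k := 1) htpp hdes
  obtain ⟨u, hu1, huxz, hux, huz, -, hvol⟩ := crux_volume_law (k := 1) htpp hdes
  have hF := volume_gt_floor_nat (p := 11) (l := 2) (by omega) hε hε1 hlt
  have hD := finrank_le_formula_nat (p := 11) (l := 2)
  simp only [Nat.reduceDiv, Nat.reducePow, Nat.reduceAdd, Nat.reduceSub] at hF hD
  have hG := card_GL_three_eleven
  have d1 : Nat.card H₁ ∣ 2124276000 := hG ▸ Subgroup.card_subgroup_dvd_card H₁
  have d2 : Nat.card H₂ ∣ 2124276000 := hG ▸ Subgroup.card_subgroup_dvd_card H₂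
  have d3 : Nat.card H₃ ∣ 2124276000 := hG ▸ Subgroup.card_subgroup_dvd_card H₃
  have hy1 := one_le_card H₂
  have hx1 := one_le_card H₁
  have hz1 := one_le_card H₃
  generalize finrank ℂ (levelSubmodule 11 (1 + 2) 1) = D at hD hvol N1 N2
  generalize Nat.card H₁ = x at *
  generalize Nat.card H₂ = y at *
  generalize Nat.card H₃ = z at *
  have hD' : D ≤ 176626 := by omega
  have hF' : 23473703 ≤ x * y * z := by omega
  have hu := lower_eleven hu1 hvol hD' hF'
  have hx : 154 ≤ x := le_trans hu hux
  have hz : 154 ≤ z := le_trans hu huz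
  have hxu : x ≤ 333 := outer_eleven hy1 hz1 N1 hD' hF'
  have N2' : z * x + z * (y - 1) ≤ D := by
    have e : z * x + z * (y - 1) = x * z + (y - 1) * z := by ring
    omega
  have hzu : z ≤ 333 := outer_eleven hy1 hx1 N2' hD' (by
    have e : z * y * x = x * y * z := by ring
    omega)
  obtain ⟨hyl, hyu⟩ := middle_eleven hx hz hy1 N1 hD' hF'
  -- divisibility strips at the outer boundary: 331, 332, 333 do not divide |GL₃(𝔽₁₁)|
  have hx' : x ≤ 330 := by
    by_contra h
    push Not at h
    interval_cases x <;> omega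
  have hz' : z ≤ 330 := by
    by_contra h
    push Not at h
    interval_cases z <;> omega
  exact ⟨⟨hx, hx'⟩, ⟨hyl, hyu⟩, ⟨hz, hz'⟩⟩

/-- **THE MEMBER WINDOW AT `(m, p) = (3, 13)`** (`−2 < ε ≤ 1`): `208 ≤ |Hᵢ| ≤ 1708`, outer
members `|H₁|, |H₃| ≤ 549`. -/
theorem member_window_three_thirteen (hp' : p = 13) {ε : ℝ} (hε : -2 < ε) (hε1 : ε ≤ 1)
    {H₁ H₂ H₃ : Subgroup (GLm p (1 + 2))} (htpp : SubgroupTPP H₁ H₂ H₃)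
    (hdes : ∃ c : Mat p (1 + 2) → ℂ, (∀ M, 1 < M.rank → c M = 0) ∧
      (∑ M, c M * ZMod.stdAddChar (Matrix.trace (M * ((1 : GLm p (1 + 2)) : Mat p (1 + 2))))) = 1 ∧
      ∀ a ∈ H₁, ∀ b ∈ H₂, ∀ g ∈ H₃, a * b * g ≠ 1 →
        (∑ M, c M * ZMod.stdAddChar
          (Matrix.trace (M * ((a * b * g : GLm p (1 + 2)) : Mat p (1 + 2))))) = 0)
    (hlt : budget p (1 + 2) 1 (2 + ε) <
      ((Nat.card H₁ * Nat.card H₂ * Nat.card H₃ : ℕ) : ℝ) ^ ((2 + ε) / 3)) :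
    (208 ≤ Nat.card H₁ ∧ Nat.card H₁ ≤ 549) ∧ (208 ≤ Nat.card H₂ ∧ Nat.card H₂ ≤ 1708) ∧
      (208 ≤ Nat.card H₃ ∧ Nat.card H₃ ≤ 549) := by
  subst hp'
  obtain ⟨N1, N2⟩ := crux_neumann (k := 1) htpp hdes
  obtain ⟨u, hu1, huxz, hux, huz, -, hvol⟩ := crux_volume_law (k := 1) htpp hdes
  have hF := volume_gt_floor_nat (p := 13) (l := 2) (by omega) hε hε1 hlt
  have hD := finrank_le_formula_nat (p := 13) (l := 2)
  simp only [Nat.reduceDiv, Nat.reducePow, Nat.reduceAdd, Nat.reduceSub] at hF hD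
  have hG := card_GL_three_thirteen
  have d1 : Nat.card H₁ ∣ 9726417792 := hG ▸ Subgroup.card_subgroup_dvd_card H₁
  have d2 : Nat.card H₂ ∣ 9726417792 := hG ▸ Subgroup.card_subgroup_dvd_card H₂
  have d3 : Nat.card H₃ ∣ 9726417792 := hG ▸ Subgroup.card_subgroup_dvd_card H₃
  have hy1 := one_le_card H₂
  have hx1 := one_le_card H₁
  have hz1 := one_le_card H₃
  generalize finrank ℂ (levelSubmodule 13 (1 + 2) 1) = D at hD hvol N1 N2
  generalize Nat.card H₁ = x at *
  generalize Nat.card H₂ = y at *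
  generalize Nat.card H₃ = z at *
  have hD' : D ≤ 401504 := by omega
  have hF' : 73441927 ≤ x * y * z := by omega
  have hu := lower_thirteen hu1 hvol hD' hF'
  have hx0 : 204 ≤ x := le_trans hu hux
  have hz0 : 204 ≤ z := le_trans hu huz
  -- divisibility strips at the lower boundary: 204, 205, 206, 207 do not divide |GL₃(𝔽₁₃)|
  have hx : 208 ≤ x := by
    by_contra h
    push Not at h
    interval_cases x <;> omega
  have hz : 208 ≤ z := by
    by_contra h
    push Not at h
    interval_cases z <;> omega
  have hxu : x ≤ 550 := outer_thirteen hy1 hz1 N1 hD' hF'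
  have N2' : z * x + z * (y - 1) ≤ D := by
    have e : z * x + z * (y - 1) = x * z + (y - 1) * z := by ring
    omega
  have hzu : z ≤ 550 := outer_thirteen hy1 hx1 N2' hD' (by
    have e : z * y * x = x * y * z := by ring
    omega)
  obtain ⟨hyl, hyu⟩ := middle_thirteen hx hz hy1 N1 hD' hF'
  have hx' : x ≤ 549 := by
    by_contra h
    push Not at h
    interval_cases x; omega
  have hz' : z ≤ 549 := by
    by_contra h
    push Not at h
    interval_cases z; omega
  have hy : 208 ≤ y := by
    by_contra h
    push Not at h
    interval_cases y <;> omega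
  have hy' : y ≤ 1708 := by
    by_contra h
    push Not at h
    interval_cases y <;> omega
  exact ⟨⟨hx, hx'⟩, ⟨hy, hy'⟩, ⟨hz, hz'⟩⟩

/-! ## Against the crux clause verbatim (`m = 3`) -/

/-- **The member window at `(3, 11)` against the crux clause verbatim** (any `−2 < ε ≤ 1`). -/
theorem crux_member_window_three_eleven (hp' : p = 11) {ε : ℝ} (hε : -2 < ε) (hε1 : ε ≤ 1)
    (H₁ H₂ H₃ : Subgroup (Matrix.GeneralLinearGroup (Fin 3) (ZMod p)))
    (htpp : Literature.Barriers.MatrixMultiplication.SubgroupTPP H₁ H₂ H₃)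
    (hdes : ∃ c : Matrix (Fin 3) (Fin 3) (ZMod p) → ℂ, (∀ M, 1 < M.rank → c M = 0) ∧
        (∑ M : Matrix (Fin 3) (Fin 3) (ZMod p), c M * ZMod.stdAddChar
          (Matrix.trace (M * ((1 : Matrix.GeneralLinearGroup (Fin 3) (ZMod p)) :
            Matrix (Fin 3) (Fin 3) (ZMod p))))) = 1 ∧
        ∀ a ∈ H₁, ∀ b ∈ H₂, ∀ g ∈ H₃, a * b * g ≠ 1 →
          (∑ M : Matrix (Fin 3) (Fin 3) (ZMod p), c M * ZMod.stdAddChar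
            (Matrix.trace (M * ((a * b * g : Matrix.GeneralLinearGroup (Fin 3) (ZMod p)) :
              Matrix (Fin 3) (Fin 3) (ZMod p))))) = 0)
    (hlt : (∑ᶠ χ ∈ Literature.RepresentationTheory.FiniteGroups.irrChars
          (Matrix.GeneralLinearGroup (Fin 3) (ZMod p)) ∩
          {f | ∃ c : Matrix (Fin 3) (Fin 3) (ZMod p) → ℂ, (∀ M, 1 < M.rank → c M = 0) ∧
            ∀ g : Matrix.GeneralLinearGroup (Fin 3) (ZMod p), f g =
              ∑ M : Matrix (Fin 3) (Fin 3) (ZMod p), c M * ZMod.stdAddChar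
                (Matrix.trace (M * (g : Matrix (Fin 3) (Fin 3) (ZMod p))))},
        (χ 1).re ^ (2 + ε)) <
        ((Nat.card H₁ * Nat.card H₂ * Nat.card H₃ : ℕ) : ℝ) ^ ((2 + ε) / 3)) :
    (154 ≤ Nat.card H₁ ∧ Nat.card H₁ ≤ 330) ∧ (154 ≤ Nat.card H₂ ∧ Nat.card H₂ ≤ 993) ∧
      (154 ≤ Nat.card H₃ ∧ Nat.card H₃ ≤ 330) :=
  member_window_three_eleven hp' hε hε1 htpp hdes hlt

/-- **The member window at `(3, 13)` against the crux clause verbatim** (any `−2 < ε ≤ 1`). -/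
theorem crux_member_window_three_thirteen (hp' : p = 13) {ε : ℝ} (hε : -2 < ε) (hε1 : ε ≤ 1)
    (H₁ H₂ H₃ : Subgroup (Matrix.GeneralLinearGroup (Fin 3) (ZMod p)))
    (htpp : Literature.Barriers.MatrixMultiplication.SubgroupTPP H₁ H₂ H₃)
    (hdes : ∃ c : Matrix (Fin 3) (Fin 3) (ZMod p) → ℂ, (∀ M, 1 < M.rank → c M = 0) ∧
        (∑ M : Matrix (Fin 3) (Fin 3) (ZMod p), c M * ZMod.stdAddChar
          (Matrix.trace (M * ((1 : Matrix.GeneralLinearGroup (Fin 3) (ZMod p)) :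
            Matrix (Fin 3) (Fin 3) (ZMod p))))) = 1 ∧
        ∀ a ∈ H₁, ∀ b ∈ H₂, ∀ g ∈ H₃, a * b * g ≠ 1 →
          (∑ M : Matrix (Fin 3) (Fin 3) (ZMod p), c M * ZMod.stdAddChar
            (Matrix.trace (M * ((a * b * g : Matrix.GeneralLinearGroup (Fin 3) (ZMod p)) :
              Matrix (Fin 3) (Fin 3) (ZMod p))))) = 0)
    (hlt : (∑ᶠ χ ∈ Literature.RepresentationTheory.FiniteGroups.irrChars
          (Matrix.GeneralLinearGroup (Fin 3) (ZMod p)) ∩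
          {f | ∃ c : Matrix (Fin 3) (Fin 3) (ZMod p) → ℂ, (∀ M, 1 < M.rank → c M = 0) ∧
            ∀ g : Matrix.GeneralLinearGroup (Fin 3) (ZMod p), f g =
              ∑ M : Matrix (Fin 3) (Fin 3) (ZMod p), c M * ZMod.stdAddChar
                (Matrix.trace (M * (g : Matrix (Fin 3) (Fin 3) (ZMod p))))},
        (χ 1).re ^ (2 + ε)) <
        ((Nat.card H₁ * Nat.card H₂ * Nat.card H₃ : ℕ) : ℝ) ^ ((2 + ε) / 3)) :
    (208 ≤ Nat.card H₁ ∧ Nat.card H₁ ≤ 549) ∧ (208 ≤ Nat.card H₂ ∧ Nat.card H₂ ≤ 1708) ∧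
      (208 ≤ Nat.card H₃ ∧ Nat.card H₃ ≤ 549) :=
  member_window_three_thirteen hp' hε hε1 htpp hdes hlt

end LevelOneMemberWindow

end Summit.MatrixMultiplication.MatrixMultiplication.Theorems.SubgroupIdentityDesigns.Negative
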